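import Mathlib
import Summits.Ventures.PercRepro2.Defs
import Summits.Ventures.PercRepro2.Graph
import Summits.Ventures.PercRepro2.OneColourSwitch
import Summits.Ventures.PercRepro2.RegionHubSign
import Summits.Ventures.PercRepro2.SideSwitch
import Summits.Ventures.PercRepro2.TermSwitchDefs
import Summits.Ventures.PercRepro2.M9NoPocketDefs
import Summits.Ventures.PercRepro2.M9PsiOneDefs
import Summits.Ventures.PercRepro2.M9PsiOneWorlds
import Summits.Ventures.PercRepro2.M9PsiOneWorldsM
import Summits.Ventures.PercRepro2.M9PsiOneSurvive

/-!
# `Ψ₁` reverses the colour preference of `p, q` (blind cell PercRepro2, p3 g31, 2026-08-28;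
`proofs/P3-PAYMENT.md` §2, claim (iii))

A `Y`-path `p → q` of `ω` avoids the `Y`-world of `ω` (Sep), so all its edges are flipped: it is
a `W`-path of `Ψ₁ ω` (`conn_compl_psiOne_of_conn`).  A `Y`-path `p → q` of `Ψ₁ ω` avoids the
`Y`-world of `Ψ₁ ω`, which contains every end of a kept edge (`M9PsiOneSurvive`), so all its
edges are flipped: it is a `W`-path of `ω` (`conn_compl_of_conn_psiOne`).  Hence
`σ_pq(Ψ₁ ω) ≤ −σ_pq(ω)` (`sigma_psiOne_le_neg`).  Own work; std axioms.
-/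

namespace Summit.Ventures.PercRepro2

namespace NoPocket

open Finset Classical RegionHub OneColourSwitch SideSwitch TermSwitch

variable {V : Type*} {E : Type*}

section Sigma

variable {ends : E → Sym2 V} {p q r s d : V} {ω : Config E}

variable (h : IsEX ends p q r s d ω)
include h

/-- An edge with both ends outside the `Y`-world of `ω` is not kept. -/
lemma not_kept_of_not_mem_K2 {x y : V} {e : E} (hends : ends e = s(x, y))
    (hx : x ∉ K2 ends r s ω) (hy : y ∉ K2 ends r s ω) : e ∉ keptEdges ends r s d ω :=
  not_kept hends (fun hx' => hx (mem_Kcore_of_mem_union hx').1)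
    (fun hy' => hy (mem_Kcore_of_mem_union hy').1)
    (fun hxd => (hx (hxd ▸ h.inK)).elim) (fun hyd => (hy (hyd ▸ h.inK)).elim)

/-- An edge with both ends outside the `Y`-world of `Ψ₁ ω` is not kept. -/
lemma not_kept_of_not_mem_K2_psiOne {x y : V} {e : E} (hends : ends e = s(x, y))
    (hx : x ∉ K2 ends r s (psiOne ends r s d ω)) (hy : y ∉ K2 ends r s (psiOne ends r s d ω)) :
    e ∉ keptEdges ends r s d ω :=
  not_kept hends (fun hx' => hx (mem_K2_psiOne_of_mem_union h hx'))
    (fun hy' => hy (mem_K2_psiOne_of_mem_union h hy'))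
    (fun hxd => (hx (by rw [hxd]; exact mem_K2_psiOne h)).elim)
    (fun hyd => (hy (by rw [hyd]; exact mem_K2_psiOne h)).elim)

/-- **A `Y`-connection of `ω` from a vertex outside the `Y`-world is a `W`-connection of
`Ψ₁ ω`.** -/
theorem conn_compl_psiOne_of_conn {a b : V} (ha : a ∉ K2 ends r s ω) (hc : Conn ends ω a b) :
    Conn ends (OneColourSwitch.compl (psiOne ends r s d ω)) a b := by
  have key : b ∈ {x | x ∉ K2 ends r s ω ∧ Conn ends (OneColourSwitch.compl (psiOne ends r s d ω)) a x} := by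
    refine mem_of_conn_of_closed (ends := ends) (ω := ω) ?_ ⟨ha, conn_refl _ _ _⟩ hc
    rintro x ⟨hxK, hxc⟩ y hxy
    obtain ⟨_, e, he, hends⟩ := openGraph_adj.1 hxy
    have hyK : y ∉ K2 ends r s ω := fun hy => hxK (mem_K2_of_open hy (ends := ends) he (ends_swap hends))
    refine ⟨hyK, conn_trans hxc (conn_of_openAdj ⟨e, ?_, hends⟩)⟩
    rw [OneColourSwitch.compl, psiOne_of_not_kept (not_kept_of_not_mem_K2 h hends hxK hyK), he]
    rfl
  exact key.2

/-- **A `Y`-connection of `Ψ₁ ω` from a vertex outside the `Y`-world of `Ψ₁ ω` is a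
`W`-connection of `ω`.** -/
theorem conn_compl_of_conn_psiOne {a b : V} (ha : a ∉ K2 ends r s (psiOne ends r s d ω))
    (hc : Conn ends (psiOne ends r s d ω) a b) : Conn ends (OneColourSwitch.compl ω) a b := by
  have key : b ∈ {x | x ∉ K2 ends r s (psiOne ends r s d ω) ∧ Conn ends (OneColourSwitch.compl ω) a x} := by
    refine mem_of_conn_of_closed (ends := ends) (ω := psiOne ends r s d ω) ?_ ⟨ha, conn_refl _ _ _⟩ hc
    rintro x ⟨hxK, hxc⟩ y hxy
    obtain ⟨_, e, he, hends⟩ := openGraph_adj.1 hxy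
    have hyK : y ∉ K2 ends r s (psiOne ends r s d ω) :=
      fun hy => hxK (mem_K2_of_open hy he (ends_swap hends))
    refine ⟨hyK, conn_trans hxc (conn_of_openAdj ⟨e, ?_, hends⟩)⟩
    rw [psiOne_of_not_kept (not_kept_of_not_mem_K2_psiOne h hends hxK hyK)] at he
    simpa [OneColourSwitch.compl] using he
  exact key.2

/-- `p` is outside the `Y`-world of `ω`. -/
lemma p_not_mem_K2 : p ∉ K2 ends r s ω := fun hp => by
  rcases mem_K2_iff.1 hp with hc | hc
  · exact h.sep.1.1 (conn_symm hc)
  · exact h.sep.1.2.1 (conn_symm hc)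

/-- `p` is outside the `Y`-world of `Ψ₁ ω`. -/
lemma p_not_mem_K2_psiOne : p ∉ K2 ends r s (psiOne ends r s d ω) := fun hp => by
  rcases mem_K2_iff.1 hp with hc | hc
  · exact (sep2_psiOne h).1.1 (conn_symm hc)
  · exact (sep2_psiOne h).1.2.1 (conn_symm hc)

/-- **`σ_pq(Ψ₁ ω) ≤ −σ_pq(ω)`.** -/
theorem sigma_psiOne_le_neg [Fintype E] [DecidableEq E] :
    sigma ends (psiOne ends r s d ω) p q ≤ - sigma ends ω p q := by
  unfold sigma
  have h1 : Conn ends ω p q → Conn ends (OneColourSwitch.compl (psiOne ends r s d ω)) p q :=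
    conn_compl_psiOne_of_conn h (p_not_mem_K2 h)
  have h2 : Conn ends (psiOne ends r s d ω) p q → Conn ends (OneColourSwitch.compl ω) p q :=
    conn_compl_of_conn_psiOne h (p_not_mem_K2_psiOne h)
  by_cases a : Conn ends ω p q <;> by_cases b : Conn ends (psiOne ends r s d ω) p q <;>
    by_cases c : Conn ends (OneColourSwitch.compl (psiOne ends r s d ω)) p q <;>
    by_cases e : Conn ends (OneColourSwitch.compl ω) p q <;> simp_all

end Sigma

end NoPocket

end Summit.Ventures.PercRepro2
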